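import Summits.Parity.BatemanHorn.Theses.AlmostPrimeZeros
import Summits.Parity.BatemanHorn.Theorems.AlmostPrimeZerosSystemLSDRealSegmentNairUpperBound

/-!
# Far moment at BOUNDED tilt — the free part of the far leaf `FarMomentWide`

Crux `AlmostPrimeZeros.SystemZeroRepulsion` (item stmt-Parity-11291), line `smooth-rough-lattice-acquisition`
(reshaped skeleton v5, lead c3), registered stub `stub_farMomentBoundedTilt`.

For every Bateman–Horn system `f = (f₁,…,f_k)` and every FIXED `T₀ ≥ 1` there is `C` with
`Σ_{0≤n≤x} t^{s_f(n)} ≤ (x+1)·exp(C(t·log log x + t²/log log x))` for all `x ≥ 3` and all `t ∈ [1, T₀]`,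
`s_f(n) = Σ_i Σ_{p^v ∥ f_i(n)} min(v,2)`.  This is the far-moment inequality of the far leaf `FarMomentWide`
(item stmt-Parity-17115) on the bounded-tilt window; it follows from the tree's Nair–Tenenbaum-light upper bound
`Σ_{n≤x} y^{s_f(n)} ≤ C₀·x(log x)^{k(y−1)}` UNIFORMLY in `y ∈ [1, T₀]` for `x ≥ x₀`
(`…SystemLSDRealSegment.BetaThinnedRootKernel.Nair.sum_pow_stat_upper_bound_uniform`, landed for crux
stmt-Parity-11292) and the budget inequality `t·L + t²/L ≥ 2t ≥ 2` (`L = log log x > 0` for `x ≥ 3`), which absorbs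
every constant and the finitely many `x < x₀`.  What remains OPEN of the far leaf on the beyond-linear class is the
GROWING-tilt regime `T₀ ≤ t ≤ √log x` (registered stub `stub_farMomentWide_beyond_growing` of the skeleton).
-/

noncomputable section

namespace Summit.Parity.BatemanHorn.Cruxes.SystemZeroRepulsion.NearFar

open scoped BigOperators
open Polynomial Finset

/-- For `x ≥ 3`, `log log x > 0` (since `e < 3`); private copy of
`Literature.Computability.QuantumComplexity.log_log_natCast_pos` (not imported: unrelated heavy module). [folklore] -/
private theorem loglog_pos_of_three_le {x : ℕ} (hx : 3 ≤ x) : 0 < Real.log (Real.log (x : ℝ)) := by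
  have hx3 : (3 : ℝ) ≤ x := by exact_mod_cast hx
  apply Real.log_pos
  rw [Real.lt_log_iff_exp_lt (by linarith)]
  exact Real.exp_one_lt_d9.trans_le (by norm_num; linarith)

/-- The far-moment budget dominates `2t`: `2t ≤ t·L + t²/L` for `L > 0`, `t ≥ 1`
(`t·L + t²/L − 2t = t(L−1)²/L + (t−1)t/L`). [folklore] -/
theorem two_mul_le_farBudget {t L : ℝ} (ht : 1 ≤ t) (hL : 0 < L) : 2 * t ≤ t * L + t ^ 2 / L := by
  have hA : 0 ≤ t * ((L - 1) ^ 2 / L) := mul_nonneg (by linarith) (div_nonneg (sq_nonneg _) hL.le)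
  have hB : 0 ≤ (t - 1) * t / L := div_nonneg (mul_nonneg (by linarith) (by linarith)) hL.le
  have h1 : t * L + t ^ 2 / L - 2 * t = t * ((L - 1) ^ 2 / L) + (t - 1) * t / L := by
    field_simp
    ring
  linarith

/-- **Bounded tilt from a uniform upper bound of the predicted order** (generic in the statistic `s`):
if `Σ_{n≤x} y^{s(n)} ≤ C₀·x(log x)^{κ(y−1)}` for all `y ∈ [1, T₀]` and all `x ≥ x₀` (`κ ≥ 0`, `C₀ > 0`), then for some `C`
and ALL `x ≥ 3`, `t ∈ [1, T₀]`: `Σ_{n≤x} t^{s(n)} ≤ (x+1)·exp(C(t·log log x + t²/log log x))`.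
Constants: `C = κ + |log C₀|/2 + max(log(B+1),0)/2`, `B = Σ_{n<x₀} T₀^{s(n)}`. [folklore] -/
theorem farMomentBoundedTilt_of_uniform (s : ℕ → ℕ) {κ : ℝ} (hκ : 0 ≤ κ) {T₀ : ℝ} (hT₀ : 1 ≤ T₀)
    {C₀ : ℝ} (hC₀ : 0 < C₀) (x₀ : ℕ)
    (hU : ∀ y : ℝ, 1 ≤ y → y ≤ T₀ → ∀ x : ℕ, x₀ ≤ x →
      ∑ n ∈ Finset.range (x + 1), y ^ (s n) ≤ C₀ * ((x : ℝ) * Real.log x ^ (κ * (y - 1)))) :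
    ∃ C : ℝ, ∀ x : ℕ, 3 ≤ x → ∀ t : ℝ, 1 ≤ t → t ≤ T₀ →
      ∑ n ∈ Finset.range (x + 1), t ^ (s n) ≤
        ((x : ℝ) + 1) * Real.exp (C * (t * Real.log (Real.log (x : ℝ)) + t ^ 2 / Real.log (Real.log (x : ℝ)))) := by
  set B : ℝ := ∑ n ∈ Finset.range x₀, T₀ ^ (s n) with hB
  have hB0 : 0 ≤ B := Finset.sum_nonneg fun n _ => pow_nonneg (by linarith) _
  refine ⟨κ + |Real.log C₀| / 2 + max (Real.log (B + 1)) 0 / 2, ?_⟩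
  intro x hx t ht htT
  have hL := loglog_pos_of_three_le hx
  set L := Real.log (Real.log (x : ℝ)) with hLdef
  have hbud : 2 * t ≤ t * L + t ^ 2 / L := two_mul_le_farBudget ht hL
  have hbud2 : 2 ≤ t * L + t ^ 2 / L := by linarith
  have hbud0 : 0 ≤ t * L + t ^ 2 / L := by linarith
  have hx1 : (1 : ℝ) ≤ (x : ℝ) + 1 := by
    have : (0 : ℝ) ≤ x := Nat.cast_nonneg _
    linarith
  have habs0 : 0 ≤ |Real.log C₀| / 2 := by positivity
  have hmax0 : 0 ≤ max (Real.log (B + 1)) 0 / 2 := by positivity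
  by_cases hxx : x₀ ≤ x
  · -- the range of the uniform bound
    have hmain := hU t ht htT x hxx
    have hlogx : 0 < Real.log (x : ℝ) := by
      have hx3 : (3 : ℝ) ≤ x := by exact_mod_cast hx
      exact Real.log_pos (by linarith)
    have hrpow : Real.log (x : ℝ) ^ (κ * (t - 1)) ≤ Real.exp (κ * (t * L + t ^ 2 / L)) := by
      rw [Real.rpow_def_of_pos hlogx, ← hLdef]
      apply Real.exp_le_exp.2
      have h2 : κ * (t * L) ≤ κ * (t * L + t ^ 2 / L) := by
        apply mul_le_mul_of_nonneg_left _ hκ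
        have : 0 ≤ t ^ 2 / L := div_nonneg (sq_nonneg _) hL.le
        linarith
      have h3 : L * (κ * (t - 1)) = κ * (t * L) - κ * L := by ring
      nlinarith [mul_nonneg hκ hL.le]
    have hC₀le : C₀ ≤ Real.exp (|Real.log C₀| / 2 * (t * L + t ^ 2 / L)) := by
      calc C₀ = Real.exp (Real.log C₀) := (Real.exp_log hC₀).symm
        _ ≤ Real.exp (|Real.log C₀| / 2 * (t * L + t ^ 2 / L)) := by
          apply Real.exp_le_exp.2
          have h1 : Real.log C₀ ≤ |Real.log C₀| := le_abs_self _
          have h2 : |Real.log C₀| * 2 ≤ |Real.log C₀| * (t * L + t ^ 2 / L) :=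
            mul_le_mul_of_nonneg_left hbud2 (abs_nonneg _)
          nlinarith
    calc ∑ n ∈ Finset.range (x + 1), t ^ (s n)
        ≤ C₀ * ((x : ℝ) * Real.log x ^ (κ * (t - 1))) := hmain
      _ ≤ Real.exp (|Real.log C₀| / 2 * (t * L + t ^ 2 / L)) *
            (((x : ℝ) + 1) * Real.exp (κ * (t * L + t ^ 2 / L))) := by
          apply mul_le_mul hC₀le _ (by positivity) (by positivity)
          exact mul_le_mul (by linarith) hrpow (by positivity) (by positivity)
      _ = ((x : ℝ) + 1) * Real.exp ((κ + |Real.log C₀| / 2) * (t * L + t ^ 2 / L)) := by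
          rw [show (κ + |Real.log C₀| / 2) * (t * L + t ^ 2 / L) =
              |Real.log C₀| / 2 * (t * L + t ^ 2 / L) + κ * (t * L + t ^ 2 / L) by ring, Real.exp_add]
          ring
      _ ≤ ((x : ℝ) + 1) *
            Real.exp ((κ + |Real.log C₀| / 2 + max (Real.log (B + 1)) 0 / 2) * (t * L + t ^ 2 / L)) := by
          apply mul_le_mul_of_nonneg_left _ (by positivity)
          apply Real.exp_le_exp.2
          apply mul_le_mul_of_nonneg_right _ hbud0
          linarith
  · -- the finitely many `x < x₀`: monotonicity in `t` and the constant `B`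
    have hxx' : x < x₀ := Nat.lt_of_not_le hxx
    have hsub : Finset.range (x + 1) ⊆ Finset.range x₀ := by
      intro n hn
      simp only [Finset.mem_range] at hn ⊢
      omega
    have hmono : ∑ n ∈ Finset.range (x + 1), t ^ (s n) ≤ B := by
      calc ∑ n ∈ Finset.range (x + 1), t ^ (s n) ≤ ∑ n ∈ Finset.range (x + 1), T₀ ^ (s n) :=
            Finset.sum_le_sum fun n _ => pow_le_pow_left₀ (by linarith) htT _
        _ ≤ ∑ n ∈ Finset.range x₀, T₀ ^ (s n) :=
            Finset.sum_le_sum_of_subset_of_nonneg hsub fun n _ _ => pow_nonneg (by linarith) _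
    have hBle : B ≤ Real.exp (max (Real.log (B + 1)) 0 / 2 * (t * L + t ^ 2 / L)) := by
      calc B ≤ B + 1 := by linarith
        _ = Real.exp (Real.log (B + 1)) := (Real.exp_log (by linarith)).symm
        _ ≤ Real.exp (max (Real.log (B + 1)) 0 / 2 * (t * L + t ^ 2 / L)) := by
            apply Real.exp_le_exp.2
            have h3 : Real.log (B + 1) ≤ max (Real.log (B + 1)) 0 := le_max_left _ _
            have h4 : 0 ≤ max (Real.log (B + 1)) 0 := le_max_right _ _
            have h5 : max (Real.log (B + 1)) 0 * 2 ≤ max (Real.log (B + 1)) 0 * (t * L + t ^ 2 / L) :=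
              mul_le_mul_of_nonneg_left hbud2 h4
            nlinarith
    calc ∑ n ∈ Finset.range (x + 1), t ^ (s n) ≤ B := hmono
      _ ≤ Real.exp (max (Real.log (B + 1)) 0 / 2 * (t * L + t ^ 2 / L)) := hBle
      _ = 1 * Real.exp (max (Real.log (B + 1)) 0 / 2 * (t * L + t ^ 2 / L)) := (one_mul _).symm
      _ ≤ ((x : ℝ) + 1) *
            Real.exp ((κ + |Real.log C₀| / 2 + max (Real.log (B + 1)) 0 / 2) * (t * L + t ^ 2 / L)) := by
          apply mul_le_mul hx1 _ (by positivity) (by positivity)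
          apply Real.exp_le_exp.2
          apply mul_le_mul_of_nonneg_right _ hbud0
          linarith

/-- **STUB `stub_farMomentBoundedTilt`** (crux stmt-Parity-11291, line `smooth-rough-lattice-acquisition`, skeleton v5):
the far-moment inequality of the far leaf `FarMomentWide` on every BOUNDED tilt window — for every Bateman–Horn system
`f` and every `T₀ ≥ 1` there is `C` with `Σ_{0≤n≤x} t^{s_f(n)} ≤ (x+1)·exp(C(t·log log x + t²/log log x))` for all
`x ≥ 3`, `1 ≤ t ≤ T₀`.  From the tree's Nair–Tenenbaum-light bound, uniform in `y ∈ [1, T₀]`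
(`sum_pow_stat_upper_bound_uniform`, crux stmt-Parity-11292), via `farMomentBoundedTilt_of_uniform`. [folklore] -/
theorem stub_farMomentBoundedTilt :
    ∀ (k : ℕ) (f : Fin k → Polynomial ℤ), Literature.NumberTheory.Sieve.IsBatemanHornSystem f →
      ∀ T₀ : ℝ, 1 ≤ T₀ →
      ∃ C : ℝ, ∀ x : ℕ, 3 ≤ x → ∀ t : ℝ, 1 ≤ t → t ≤ T₀ →
        (∑ n ∈ Finset.range (x + 1),
            (t : ℝ) ^ (∑ i, (((f i).eval (n : ℤ)).toNat.factorization.sum fun _ v => min v 2))) ≤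
          ((x : ℝ) + 1) *
            Real.exp (C * (t * Real.log (Real.log (x : ℝ)) + t ^ 2 / Real.log (Real.log (x : ℝ)))) := by
  intro k f hf T₀ hT₀
  obtain ⟨C₀, hC₀, x₀, hU⟩ :=
    Summit.Parity.BatemanHorn.Cruxes.SystemLSDRealSegment.BetaThinnedRootKernel.Nair.sum_pow_stat_upper_bound_uniform
      hf hT₀
  exact farMomentBoundedTilt_of_uniform
    (fun n => ∑ i, (((f i).eval (n : ℤ)).toNat.factorization.sum fun _ v => min v 2))
    (Nat.cast_nonneg k) hT₀ hC₀ x₀ hU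

end Summit.Parity.BatemanHorn.Cruxes.SystemZeroRepulsion.NearFar

end
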